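import Mathlib.Analysis.SpecialFunctions.Trigonometric.Series
import Mathlib.Analysis.Complex.ExponentialBounds
import Summits.AnomalousDissipation.AnomalousDissipation.Theorems.MarginalStabilityChainStretchedVortexRowsStubBraidExitLeibniz
import Summits.AnomalousDissipation.AnomalousDissipation.Theorems.MarginalStabilityChainStretchedVortexRowsStubBraidExitBounds

/-!
# Tools for the stub `stub_braidExit` (r4; line `braid-closed-large-circulation-gluing`, crux
# stmt-AnomalousDissipation-3009), part F: the exit function `exitPhi` — definition, regularity,
# periodicity, nonnegativity, size, and the elementary facts of the assembly

`exitPhi L M Λ s₀ k (x, y) = M · (G(log D) + k · S · W₀(log D) + 10k)` with `G = logProfile Λ s₀`,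
`S = sin a sinh b`, `W₀ = decayProfile` (parts A, B, D). In `stub_braidExit` it is used with
`Λ = 1 + log(L²/ν)`, `s₀ = log(1 − cos(2πr/L))` (the minimum of `log D` on the closed outer domain),
`k = κL/π`, `κ = 10⁻⁵`, `M = 4·10⁴ L²/ρ₀²`.

* `rowE_ge_of_forall_saddle` — off the saddle discs of radius `ρ₀` about `((n+½)L, 0)`:
  `E = cosh b + cos a ≥ 8ρ₀²/L²` (registered def-free form `stub_braidExit_saddleDistance`);
* hyperbolic numerics: `sinh_le_mul_cosh`, `abs_sinh_le`, `strip_hyp` (`|b| ≤ 1/4 ⇒ cosh b ≤ 26/25`,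
  `|sinh b| ≤ 13/50`), `cosh_le_exp_abs`, `log_cosh_add_one_le`, `two_lt_log_eight`,
  `log_sixteen_lt`;
* `radialLayer_decayProfile` (`W₀(log D) = 100/(10 + D)²` on `{D > 0}`), `abs_rowS_mul_weight_le`
  (`|S·W₀(log D)| ≤ 10`);
* `exitPhi` and: `contDiffOn_exitPhi` (`Cⁿ` on `{D > 0, log D > s₀ − Λ}`), `exitPhi_periodic`,
  `exitPhi_nonneg` (where `log D ≥ s₀`), `exitPhi_le` (`≤ 3MΛ(1 + log(1 + |y|/L))` where `log D ≥ s₀`,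
  given `Λ ≥ 1`, `3 − Λ ≤ s₀`, `0 ≤ k ≤ 10⁻⁵`), `exit_params` (`Λ ≥ 1`, `1 − cos(2πr/L) ≥ 8r²/L²`,
  `3 − Λ ≤ s₀`, `4πν/L ≤ 4/5` from `0 < ν ≤ r²`, `0 < r ≤ L/4`, `L ≤ 1`), `exit_closure` (on the
  closure of the r4 outer domain: `D ≥ 1 − cos(2πr/L)` and `ρ₀² ≤ (x − (n+½)L)² + y²`).
-/

-- `Summit.<Summit>.<Problem>` is the mandated summit-side namespace (CONVENTIONS §2): duplicate deliberate.
set_option linter.dupNamespace false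

noncomputable section

open scoped Topology
open Filter Set

namespace Summit.AnomalousDissipation.AnomalousDissipation.Theorems.MarginalStabilityChainStretchedVortexRows.BraidExit

open Literature.Analysis.FluidPDE Literature.Analysis.FluidPDE.StretchedLayer

variable {L : ℝ}

/-! ### Distance to the saddles controls `E` from below -/

/-- **Off the saddle discs `E` is bounded below**: if `(x, y)` is outside the open discs of radius
`ρ₀` about the saddles `((n+½)L, 0)`, then `E = cosh b + cos a ≥ 8ρ₀²/L²`
(`cosh b − 1 ≥ b²/2`, `1 + cos a = 1 − cos α ≥ 2α²/π²` for the scaled distance `α` to the nearest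
saddle column, and `α² + b² ≥ (2πρ₀/L)²`). [folklore] -/
theorem rowE_ge_of_forall_saddle (hL : 0 < L) {ρ₀ x y : ℝ}
    (h : ∀ n : ℤ, ρ₀ ^ 2 ≤ (x - (n + 1 / 2) * L) ^ 2 + y ^ 2) :
    8 * ρ₀ ^ 2 / L ^ 2 ≤ rowE L x y := by
  set n₀ : ℤ := round (x / L - 1 / 2) with hn₀
  set d : ℝ := x - (n₀ + 1 / 2) * L with hd
  have hdle : |d| ≤ L / 2 := by
    have h1 := abs_sub_round (x / L - 1 / 2)
    have : d = L * (x / L - 1 / 2 - round (x / L - 1 / 2)) := by rw [hd, hn₀]; field_simp; ring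
    rw [this, abs_mul, abs_of_pos hL]
    nlinarith
  set α : ℝ := 2 * Real.pi * d / L with hα
  have hαπ : |α| ≤ Real.pi := by
    rw [hα, abs_div, abs_mul, abs_of_pos hL, abs_of_pos (by positivity : (0:ℝ) < 2 * Real.pi),
      div_le_iff₀ hL]
    nlinarith [Real.pi_pos]
  have hcos : Real.cos (2 * Real.pi * x / L) = -Real.cos α := by
    have : 2 * Real.pi * x / L = α + (n₀ : ℝ) * (2 * Real.pi) + Real.pi := by
      rw [hα, hd]; field_simp; ring
    rw [this, Real.cos_add_pi, Real.cos_add_int_mul_two_pi]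
  set b : ℝ := 2 * Real.pi * y / L with hb
  have h1 : Real.cos α ≤ 1 - 2 / Real.pi ^ 2 * α ^ 2 := Real.cos_le_one_sub_mul_cos_sq hαπ
  have h2 : b ^ 2 / 2 ≤ Real.cosh b - 1 := sq_div_two_le_cosh_sub_one b
  have hπ : (3 : ℝ) < Real.pi := Real.pi_gt_three
  have hπ2 : 2 / Real.pi ^ 2 ≤ 1 / 2 := by
    rw [div_le_div_iff₀ (by positivity) (by norm_num)]; nlinarith
  have h3 : α ^ 2 + b ^ 2 = (2 * Real.pi / L) ^ 2 * (d ^ 2 + y ^ 2) := by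
    rw [hα, hb]; field_simp
  have h4 : ρ₀ ^ 2 ≤ d ^ 2 + y ^ 2 := by have := h n₀; rwa [← hd] at this
  unfold rowE
  rw [hcos, ← hb]
  have h5 : 2 / Real.pi ^ 2 * (α ^ 2 + b ^ 2) ≤ Real.cosh b - Real.cos α := by
    nlinarith [mul_le_mul_of_nonneg_right hπ2 (sq_nonneg b)]
  have h6 : 8 * ρ₀ ^ 2 / L ^ 2 ≤ 2 / Real.pi ^ 2 * (α ^ 2 + b ^ 2) := by
    rw [h3, show 2 / Real.pi ^ 2 * ((2 * Real.pi / L) ^ 2 * (d ^ 2 + y ^ 2)) =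
      8 / L ^ 2 * (d ^ 2 + y ^ 2) by field_simp; ring]
    rw [show 8 * ρ₀ ^ 2 / L ^ 2 = 8 / L ^ 2 * ρ₀ ^ 2 by ring]
    exact mul_le_mul_of_nonneg_left h4 (by positivity)
  linarith

/-! ### Hyperbolic numerics in the strip `|b| ≤ 1/4` and beyond -/

/-- `sinh t ≤ t cosh t` for `t ≥ 0`. [folklore] -/
theorem sinh_le_mul_cosh {t : ℝ} (ht : 0 ≤ t) : Real.sinh t ≤ t * Real.cosh t := by
  have hmono : MonotoneOn (fun s : ℝ => s * Real.cosh s - Real.sinh s) (Ici 0) := by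
    refine monotoneOn_of_deriv_nonneg (convex_Ici 0) (by fun_prop) (by fun_prop) fun w hw => ?_
    rw [interior_Ici] at hw
    have hd2 : HasDerivAt (fun s : ℝ => s * Real.cosh s - Real.sinh s)
        (1 * Real.cosh w + w * Real.sinh w - Real.cosh w) w :=
      ((hasDerivAt_id w).mul (Real.hasDerivAt_cosh w)).sub (Real.hasDerivAt_sinh w)
    rw [hd2.deriv]
    have hw' : 0 < w := hw
    have := Real.sinh_nonneg_iff.2 hw'.le
    nlinarith [mul_nonneg hw'.le this]
  have := hmono (self_mem_Ici) ht ht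
  simp at this
  linarith

/-- `|sinh b| ≤ |b| cosh b`. [folklore] -/
theorem abs_sinh_le (b : ℝ) : |Real.sinh b| ≤ |b| * Real.cosh b := by
  rw [Real.abs_sinh, ← Real.cosh_abs]
  exact sinh_le_mul_cosh (abs_nonneg b)

/-- In the strip `|b| ≤ 1/4`: `cosh b ≤ 26/25` and `|sinh b| ≤ 13/50`. [folklore] -/
theorem strip_hyp {b : ℝ} (hb : |b| ≤ 1 / 4) : Real.cosh b ≤ 26 / 25 ∧ |Real.sinh b| ≤ 13 / 50 := by
  have h1 : Real.cosh b ≤ Real.exp (b ^ 2 / 2) := Real.cosh_le_exp_half_sq b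
  have hb2 : b ^ 2 / 2 ≤ 1 / 32 := by
    have : b ^ 2 ≤ (1 / 4) ^ 2 := by rw [← sq_abs]; exact pow_le_pow_left₀ (abs_nonneg b) hb 2
    linarith
  have h2 : Real.exp (b ^ 2 / 2) ≤ 26 / 25 := by
    have h3 := Real.abs_exp_sub_one_sub_id_le (x := b ^ 2 / 2) (by rw [abs_le]; constructor <;> nlinarith)
    rw [abs_le] at h3
    nlinarith [sq_nonneg (b ^ 2 / 2)]
  have hB : Real.cosh b ≤ 26 / 25 := h1.trans h2
  refine ⟨hB, ?_⟩
  calc |Real.sinh b| ≤ |b| * Real.cosh b := abs_sinh_le b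
    _ ≤ 1 / 4 * (26 / 25) := mul_le_mul hb hB (Real.cosh_pos b).le (by norm_num)
    _ = 13 / 50 := by norm_num

/-- `cosh x ≤ exp |x|`. [folklore] -/
theorem cosh_le_exp_abs (x : ℝ) : Real.cosh x ≤ Real.exp |x| := by
  rw [Real.cosh_eq]
  have h1 : Real.exp x ≤ Real.exp |x| := Real.exp_le_exp.2 (le_abs_self x)
  have h2 : Real.exp (-x) ≤ Real.exp |x| := Real.exp_le_exp.2 (neg_le_abs x)
  linarith

/-- `log(cosh b + 1) ≤ |b| + 1` (`cosh b + 1 ≤ 2e^{|b|} ≤ e^{|b| + 1}`). [folklore] -/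
theorem log_cosh_add_one_le (b : ℝ) : Real.log (Real.cosh b + 1) ≤ |b| + 1 := by
  have h1 : Real.cosh b + 1 ≤ Real.exp (|b| + 1) := by
    rw [Real.exp_add]
    have h2 := cosh_le_exp_abs b
    have h3 : (2 : ℝ) ≤ Real.exp 1 := by linarith [Real.add_one_le_exp (1 : ℝ)]
    have h4 : (1 : ℝ) ≤ Real.exp |b| := Real.one_le_exp (abs_nonneg b)
    nlinarith [Real.exp_pos |b|]
  have hpos : 0 < Real.cosh b + 1 := by linarith [Real.cosh_pos b]
  calc Real.log (Real.cosh b + 1) ≤ Real.log (Real.exp (|b| + 1)) := Real.log_le_log hpos h1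
    _ = |b| + 1 := Real.log_exp _

/-- `2 < log 8` (`e² < 7.39 < 8`). [folklore] -/
theorem two_lt_log_eight : (2 : ℝ) < Real.log 8 := by
  rw [Real.lt_log_iff_exp_lt (by norm_num)]
  have h := Real.exp_one_lt_d9
  have : Real.exp 2 = Real.exp 1 * Real.exp 1 := by rw [← Real.exp_add]; norm_num
  rw [this]
  nlinarith [Real.exp_pos (1:ℝ)]

/-- `log 16 < 2.78`. [folklore] -/
theorem log_sixteen_lt : Real.log 16 < 278 / 100 := by
  have : Real.log 16 = 4 * Real.log 2 := by
    rw [show (16 : ℝ) = 2 ^ 4 by norm_num, Real.log_pow]; norm_num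
  rw [this]
  linarith [Real.log_two_lt_d9]

/-! ### The corrector is bounded and the weight is explicit -/

/-- On `{D > 0}` the weight `W₀(log D)` is `100/(10 + D)²`. [folklore] -/
theorem radialLayer_decayProfile {x y : ℝ} (hD : 0 < rowD L x y) :
    radialLayer L decayProfile x y = 100 / (10 + rowD L x y) ^ 2 := by
  unfold radialLayer decayProfile
  rw [Real.exp_log hD]

/-- `|S · W₀(log D)| ≤ 10` on `{D > 0}` (`|S| ≤ cosh b ≤ D + 1`, `100(D + 1) ≤ 10(10 + D)²`). [folklore] -/
theorem abs_rowS_mul_weight_le {x y : ℝ} (hD : 0 < rowD L x y) :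
    |rowS L x y * radialLayer L decayProfile x y| ≤ 10 := by
  rw [radialLayer_decayProfile hD, abs_mul,
    abs_of_nonneg (by positivity : (0:ℝ) ≤ 100 / (10 + rowD L x y) ^ 2)]
  have h1 : |rowS L x y| ≤ rowD L x y + 1 := by
    unfold rowS rowD
    rw [abs_mul]
    have h2 : |Real.sin (2 * Real.pi * x / L)| ≤ 1 := Real.abs_sin_le_one _
    have h3 : |Real.sinh (2 * Real.pi * y / L)| ≤ Real.cosh (2 * Real.pi * y / L) := by
      rw [Real.abs_sinh, ← Real.cosh_abs]; exact (Real.sinh_lt_cosh _).le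
    have h4 := Real.cos_le_one (2 * Real.pi * x / L)
    calc |Real.sin (2 * Real.pi * x / L)| * |Real.sinh (2 * Real.pi * y / L)|
        ≤ 1 * Real.cosh (2 * Real.pi * y / L) := mul_le_mul h2 h3 (abs_nonneg _) zero_le_one
      _ ≤ _ := by linarith
  set D := rowD L x y
  calc |rowS L x y| * (100 / (10 + D) ^ 2) ≤ (D + 1) * (100 / (10 + D) ^ 2) :=
        mul_le_mul_of_nonneg_right h1 (by positivity)
    _ ≤ 10 := by
      rw [← mul_div_assoc, div_le_iff₀ (by positivity)]
      nlinarith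

/-! ### The exit function -/

/-- **The exit function** `φ = M · (G(log D) + k · S · W₀(log D) + 10k)` of `stub_braidExit` (r4):
radial layer (part A) with profile `G = logProfile Λ s₀` (part D), corrector `S = rowS` (part B)
damped by `W₀(log D) = (10/(10 + D))²` (part D), shifted by `10k` to be nonnegative. [folklore] -/
def exitPhi (L M Λ s₀ k : ℝ) : ℝ → ℝ → ℝ := fun x y =>
  M * (radialLayer L (logProfile Λ s₀) x y + k * (rowS L x y * radialLayer L decayProfile x y) + 10 * k)

/-- `S` is smooth on the plane (jointly). [folklore] -/
theorem contDiff_rowS (L : ℝ) {n : WithTop ℕ∞} : ContDiff ℝ n (fun q : ℝ × ℝ => rowS L q.1 q.2) := by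
  unfold rowS; fun_prop

/-- **Regularity**: `exitPhi` is `Cⁿ` on `{D > 0, log D ∈ (s₀ − Λ, ∞)}`. [folklore] -/
theorem contDiffOn_exitPhi (L M Λ s₀ k : ℝ) {n : WithTop ℕ∞} :
    ContDiffOn ℝ n (fun q : ℝ × ℝ => exitPhi L M Λ s₀ k q.1 q.2)
      {q : ℝ × ℝ | 0 < rowD L q.1 q.2 ∧ Real.log (rowD L q.1 q.2) ∈ Ioi (s₀ - Λ)} := by
  have h1 : ContDiffOn ℝ n (fun q : ℝ × ℝ => radialLayer L (logProfile Λ s₀) q.1 q.2)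
      {q : ℝ × ℝ | 0 < rowD L q.1 q.2 ∧ Real.log (rowD L q.1 q.2) ∈ Ioi (s₀ - Λ)} :=
    contDiffOn_radialLayer (contDiffOn_logProfile Λ s₀)
  have h2 : ContDiffOn ℝ n (fun q : ℝ × ℝ => radialLayer L decayProfile q.1 q.2)
      {q : ℝ × ℝ | 0 < rowD L q.1 q.2 ∧ Real.log (rowD L q.1 q.2) ∈ Ioi (s₀ - Λ)} :=
    (contDiffOn_radialLayer (U := univ) contDiff_decayProfile.contDiffOn).mono
      fun q hq => ⟨hq.1, mem_univ _⟩
  have h3 := (contDiff_rowS L (n := n)).contDiffOn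
    (s := {q : ℝ × ℝ | 0 < rowD L q.1 q.2 ∧ Real.log (rowD L q.1 q.2) ∈ Ioi (s₀ - Λ)})
  unfold exitPhi
  exact contDiffOn_const.mul ((h1.add (contDiffOn_const.mul (h3.mul h2))).add contDiffOn_const)

/-- **Periodicity**: `exitPhi (x + L) y = exitPhi x y` (`L ≠ 0`). [folklore] -/
theorem exitPhi_periodic (hL : L ≠ 0) (M Λ s₀ k x y : ℝ) :
    exitPhi L M Λ s₀ k (x + L) y = exitPhi L M Λ s₀ k x y := by
  unfold exitPhi
  have hS : rowS L (x + L) y = rowS L x y := by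
    unfold rowS
    have : 2 * Real.pi * (x + L) / L = 2 * Real.pi * x / L + 2 * Real.pi := by field_simp
    rw [this, Real.sin_add_two_pi]
  rw [radialLayer_periodic hL, radialLayer_periodic hL, hS]

/-- **Nonnegativity** where `D > 0` and `log D ≥ s₀` (`M, k ≥ 0`, `Λ > 0`): `G(log D) ≥ 0` and
`k·S·W₀ + 10k ≥ 0`. [folklore] -/
theorem exitPhi_nonneg {M Λ s₀ k : ℝ} (hM : 0 ≤ M) (hk : 0 ≤ k) (hΛ : 0 < Λ) {x y : ℝ}
    (hD : 0 < rowD L x y) (hℓ : s₀ ≤ Real.log (rowD L x y)) : 0 ≤ exitPhi L M Λ s₀ k x y := by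
  unfold exitPhi
  have h1 : 0 ≤ radialLayer L (logProfile Λ s₀) x y := by
    unfold radialLayer logProfile
    refine mul_nonneg hΛ.le (sub_nonneg.2 (Real.log_le_log hΛ (by linarith)))
  have h2 := abs_rowS_mul_weight_le (L := L) hD
  rw [abs_le] at h2
  have h3 : 0 ≤ k * (rowS L x y * radialLayer L decayProfile x y) + 10 * k := by nlinarith
  exact mul_nonneg hM (by linarith)

/-- **Size** where `D > 0`, `log D ≥ s₀`: `exitPhi ≤ 3MΛ(1 + log(1 + |y|/L))`, given `Λ ≥ 1`,
`3 − Λ ≤ s₀`, `0 ≤ k ≤ 10⁻⁵` (`log D ≤ log(cosh b + 1) ≤ |b| + 1`, so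
`log((Λ + log D − s₀)/Λ) ≤ log(2 + |b|) ≤ log(4π) + log(1 + |y|/L) < 2.78 + log(1 + |y|/L)`).
[folklore] -/
theorem exitPhi_le (hL : 0 < L) {M Λ s₀ k : ℝ} (hM : 0 ≤ M) (hk0 : 0 ≤ k) (hk : k ≤ 1 / 100000)
    (hΛ : 1 ≤ Λ) (hs₀ : 3 - Λ ≤ s₀) {x y : ℝ} (hD : 0 < rowD L x y)
    (hℓ : s₀ ≤ Real.log (rowD L x y)) :
    exitPhi L M Λ s₀ k x y ≤ 3 * M * Λ * (1 + Real.log (1 + |y| / L)) := by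
  unfold exitPhi
  set ℓ := Real.log (rowD L x y) with hℓdef
  set b := 2 * Real.pi * y / L with hb
  have hπ3 : (3 : ℝ) < Real.pi := Real.pi_gt_three
  have hπ4 : Real.pi < 3.15 := Real.pi_lt_d2
  have hlog0 : 0 ≤ Real.log (1 + |y| / L) := Real.log_nonneg (by
    have : 0 ≤ |y| / L := by positivity
    linarith)
  -- the profile
  have hℓle : ℓ ≤ |b| + 1 := by
    have h1 : rowD L x y ≤ Real.cosh b + 1 := rowD_le L x y
    calc ℓ ≤ Real.log (Real.cosh b + 1) := Real.log_le_log hD h1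
      _ ≤ |b| + 1 := log_cosh_add_one_le b
  have habs : |b| = 2 * Real.pi * |y| / L := by
    rw [hb, abs_div, abs_mul, abs_of_pos hL, abs_of_pos (by positivity : (0:ℝ) < 2 * Real.pi)]
  have hpos : 0 < Λ + ℓ - s₀ := by linarith
  have hup : Λ + ℓ - s₀ ≤ Λ * (4 * Real.pi * (1 + |y| / L)) := by
    have h1 : Λ + ℓ - s₀ ≤ 2 * Λ + |b| := by linarith
    have h2 : 2 * Λ + |b| ≤ Λ * (2 + |b|) := by nlinarith [abs_nonneg b]
    have h3 : 2 + |b| ≤ 4 * Real.pi * (1 + |y| / L) := by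
      rw [habs]
      have : 0 ≤ |y| / L := by positivity
      have h4 : 2 * Real.pi * |y| / L = 2 * Real.pi * (|y| / L) := by ring
      rw [h4]; nlinarith
    calc Λ + ℓ - s₀ ≤ Λ * (2 + |b|) := h1.trans h2
      _ ≤ Λ * (4 * Real.pi * (1 + |y| / L)) := mul_le_mul_of_nonneg_left h3 (by linarith)
  have hG : radialLayer L (logProfile Λ s₀) x y ≤ Λ * (278 / 100 + Real.log (1 + |y| / L)) := by
    unfold radialLayer logProfile
    rw [← hℓdef]
    refine mul_le_mul_of_nonneg_left ?_ (by linarith)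
    have h1 : Real.log (Λ + ℓ - s₀) ≤ Real.log (Λ * (4 * Real.pi * (1 + |y| / L))) :=
      Real.log_le_log hpos hup
    have h2 : Real.log (Λ * (4 * Real.pi * (1 + |y| / L))) =
        Real.log Λ + (Real.log (4 * Real.pi) + Real.log (1 + |y| / L)) := by
      rw [Real.log_mul (by positivity) (by positivity), Real.log_mul (by positivity) (by positivity)]
    have h3 : Real.log (4 * Real.pi) ≤ Real.log 16 :=
      Real.log_le_log (by positivity) (by linarith)
    linarith [log_sixteen_lt]
  -- the corrector
  have h2 := abs_rowS_mul_weight_le (L := L) hD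
  rw [abs_le] at h2
  have hcorr : k * (rowS L x y * radialLayer L decayProfile x y) + 10 * k ≤ 20 * k := by nlinarith
  have hsum : radialLayer L (logProfile Λ s₀) x y +
      k * (rowS L x y * radialLayer L decayProfile x y) + 10 * k ≤
      3 * Λ * (1 + Real.log (1 + |y| / L)) := by nlinarith
  calc M * (radialLayer L (logProfile Λ s₀) x y +
        k * (rowS L x y * radialLayer L decayProfile x y) + 10 * k)
      ≤ M * (3 * Λ * (1 + Real.log (1 + |y| / L))) := mul_le_mul_of_nonneg_left hsum hM
    _ = 3 * M * Λ * (1 + Real.log (1 + |y| / L)) := by ring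

/-! ### Parameters and the closed outer domain -/

/-- The parameter facts of the assembly: `Λ = 1 + log(L²/ν) ≥ 1`, `1 − cos(2πr/L) ≥ 8r²/L²`,
`3 − Λ ≤ s₀ = log(1 − cos(2πr/L))`, `4πν/L ≤ 4/5` (from `0 < ν ≤ r²`, `0 < r ≤ L/4`, `L ≤ 1`).
[folklore] -/
theorem exit_params (hL : 0 < L) (hL1 : L ≤ 1) {ν r : ℝ} (hν : 0 < ν) (hr : 0 < r) (hνr : ν ≤ r ^ 2)
    (hrL : r ≤ L / 4) :
    1 ≤ 1 + Real.log (L ^ 2 / ν) ∧ 8 * r ^ 2 / L ^ 2 ≤ 1 - Real.cos (2 * Real.pi * r / L) ∧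
      3 - (1 + Real.log (L ^ 2 / ν)) ≤ Real.log (1 - Real.cos (2 * Real.pi * r / L)) ∧
      4 * Real.pi * ν / L ≤ 4 / 5 := by
  have hπ3 : (3 : ℝ) < Real.pi := Real.pi_gt_three
  have hπ4 : Real.pi < 3.15 := Real.pi_lt_d2
  have hνL : 16 * ν ≤ L ^ 2 := by nlinarith
  have hq : 16 ≤ L ^ 2 / ν := by rw [le_div_iff₀ hν]; linarith
  have hΛ : 0 ≤ Real.log (L ^ 2 / ν) := Real.log_nonneg (by linarith)
  have hDr : 8 * r ^ 2 / L ^ 2 ≤ 1 - Real.cos (2 * Real.pi * r / L) := by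
    have habs : |2 * Real.pi * r / L| ≤ Real.pi := by
      rw [abs_of_nonneg (by positivity), div_le_iff₀ hL]; nlinarith
    have h := Real.cos_le_one_sub_mul_cos_sq habs
    have : 2 / Real.pi ^ 2 * (2 * Real.pi * r / L) ^ 2 = 8 * r ^ 2 / L ^ 2 := by
      field_simp; ring
    linarith
  refine ⟨by linarith, hDr, ?_, ?_⟩
  · have h8 : 0 < 8 * r ^ 2 / L ^ 2 := by positivity
    have h1 : Real.log (8 * r ^ 2 / L ^ 2) ≤ Real.log (1 - Real.cos (2 * Real.pi * r / L)) :=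
      Real.log_le_log h8 hDr
    have h2 : Real.log (8 * r ^ 2 / L ^ 2) = Real.log 8 + Real.log (r ^ 2) - Real.log (L ^ 2) := by
      rw [Real.log_div (by positivity) (by positivity), Real.log_mul (by norm_num) (by positivity)]
    have h3 : Real.log (L ^ 2 / ν) = Real.log (L ^ 2) - Real.log ν :=
      Real.log_div (by positivity) hν.ne'
    have h4 : Real.log ν ≤ Real.log (r ^ 2) := Real.log_le_log hν hνr
    linarith [two_lt_log_eight]
  · have h1 : 4 * Real.pi * ν / L ≤ 4 * Real.pi * (L ^ 2 / 16) / L :=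
      div_le_div_of_nonneg_right (by nlinarith) hL.le
    have h2 : 4 * Real.pi * (L ^ 2 / 16) / L = Real.pi * L / 4 := by field_simp; ring
    rw [h2] at h1
    nlinarith

/-- On the closure of the r4 outer domain: `D ≥ 1 − cos(2πr/L)` (part B) and the point is outside
the OPEN saddle discs. [folklore] -/
theorem exit_closure (hL : 0 < L) {ρ₀ r : ℝ} (hr : 0 < r) (hrL : r ≤ L / 4) {q : ℝ × ℝ}
    (hq : q ∈ closure {q : ℝ × ℝ | (∀ n : ℤ, r ^ 2 < (q.1 - n * L) ^ 2 + q.2 ^ 2) ∧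
      ∀ n : ℤ, ρ₀ ^ 2 < (q.1 - (n + 1 / 2) * L) ^ 2 + q.2 ^ 2}) :
    1 - Real.cos (2 * Real.pi * r / L) ≤ rowD L q.1 q.2 ∧
      ∀ n : ℤ, ρ₀ ^ 2 ≤ (q.1 - (n + 1 / 2) * L) ^ 2 + q.2 ^ 2 := by
  have h1 : q ∈ closure {q : ℝ × ℝ | ∀ n : ℤ, r ^ 2 < (q.1 - n * L) ^ 2 + q.2 ^ 2} :=
    closure_mono (fun p hp => hp.1) hq
  have h2 : q ∈ {q : ℝ × ℝ | ∀ n : ℤ, ρ₀ ^ 2 ≤ (q.1 - (n + 1 / 2) * L) ^ 2 + q.2 ^ 2} := by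
    refine closure_minimal (fun p hp n => (hp.2 n).le) ?_ hq
    have : {q : ℝ × ℝ | ∀ n : ℤ, ρ₀ ^ 2 ≤ (q.1 - (n + 1 / 2) * L) ^ 2 + q.2 ^ 2} =
        ⋂ n : ℤ, {q : ℝ × ℝ | ρ₀ ^ 2 ≤ (q.1 - (n + 1 / 2) * L) ^ 2 + q.2 ^ 2} := by
      ext p; simp
    rw [this]
    exact isClosed_iInter fun n => isClosed_le continuous_const (by fun_prop)
  exact ⟨cosh_sub_cos_ge_of_forall hL hr hrL (closure_outer_subset L r h1), h2⟩

/-- **Registered sub-goal `stub_braidExit_saddleDistance`** (def-free form of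
`rowE_ge_of_forall_saddle`). [folklore] -/
theorem stub_braidExit_saddleDistance : ∀ (L ρ₀ x y : ℝ), 0 < L → (∀ n : ℤ, ρ₀ ^ 2 ≤ (x - (n + 1 / 2) * L) ^ 2 + y ^ 2) → 8 * ρ₀ ^ 2 / L ^ 2 ≤ Real.cosh (2 * Real.pi * y / L) + Real.cos (2 * Real.pi * x / L) := by
  intro L ρ₀ x y hL h
  exact rowE_ge_of_forall_saddle hL h

end Summit.AnomalousDissipation.AnomalousDissipation.Theorems.MarginalStabilityChainStretchedVortexRows.BraidExit

end
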